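import Literature.Probability.RandomPlanarGeometry.HexSAWHexagonSurgery
import HarnessLib

/-!
# The double transfer `Σ_ω I(ω)(I(ω)−324)₊/((J(ω)+24)(J(ω)+48)) ≤ c_{N+4}(ℍ)` (Madras–Slade (7.3.7), hexagon-surgery variant)

Topic `Literature/Probability/RandomPlanarGeometry` (continues `HexSAWHexagonSurgery.lean`: the hexagonal-lattice surgery `hexIns`/`hexDel`
— two consecutive edges of a hexagon replaced by the other four —, the slot and deletion-site counts `hexSlots` (`I`) / `hexSharp` (`J`),
the pair bijection `sum_hexSlotPairs_eq_sum_hexSharpPairs`, and the bounded bookkeeping `1 ≤ J' ≤ J + 24`, `I ≤ I' + 324`).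

Source: N. Madras, G. Slade, *The Self-Avoiding Walk* (1993), proof of Theorem 7.3.2, eq. (7.3.7) (p. 245): the LOWER bound for the
count two surgeries on, by counting pairs (walk, surgery site) twice; printed for `ℤ^d` (Theorem 7.3.4(a), Kesten 1963), here for the
hexagonal lattice `ℍ` (never written out in print; lane «pcv-sawmu» HEX-RATIO-2, block (P2-ℍ)) — the `ℍ` twin of the tree's
`SAW.triKesten_P2` (`SAWTriangularDoubleTransfer.lean`) and `KestenHairpin.sum_le_count_add_four`.

## What is here (namespace `Literature.Probability.RandomPlanarGeometry.SAW.HV`; all proved, axioms standard)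

* `sum_card_hexSlots_div_le_hexSawCount` — level `N+2`: `Σ_{ω' ∈ S_{N+2}(ℍ)} I(ω')/(J(ω')+24) ≤ c_{N+4}(ℍ)`;
* **`hexKesten_P2`** — `Σ_{ω ∈ S_N(ℍ)} I(ω)·max(0, I(ω)−324)/((J(ω)+24)(J(ω)+48)) ≤ c_{N+4}(ℍ)`.
-/

noncomputable section

open Finset
open Literature.Probability.LatticeModels Literature.Probability.Percolation SimpleGraph

namespace Literature.Probability.RandomPlanarGeometry.SAW.HV

/-! ## (P2-ℍ) The double transfer: a lower bound for `c_{N+4}(ℍ)` (Madras–Slade (7.3.7), hexagon-surgery variant)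

Lane «pcv-sawmu» HEX-RATIO-2, block (P2-ℍ): the `ℍ` twin of the tree's `KestenHairpin.sum_le_count_add_four` and of
`SAW.hexKesten_P2`, with the hexagon surgery `hexIns` (two edges of a hexagon replaced by the other four) and the inexact
bookkeeping `1 ≤ J' ≤ J + 24`, `I ≤ I' + 324` of `HexSAWHexagonSurgery`. -/

section DoubleTransfer

/-- **Level `N+2` (single step of (7.3.7))**: `Σ_{ω' ∈ S_{N+2}(ℍ)} I(ω')/(J(ω')+24) ≤ c_{N+4}(ℍ)` — each slot pair `(ω', s)` is sent
to the deletion-site pair `(hexIns s ω', ·)`, a walk `ω''` of `S_{N+4}` receiving exactly `J(ω'')` of them, and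
`J(hexIns s ω') ≤ J(ω') + 24`. [cite: MadrasSlade1993, Theorem 7.3.2 (proof), eq. (7.3.7)] -/
theorem sum_card_hexSlots_div_le_hexSawCount (N : ℕ) :
    ∑ ω ∈ sawFin hvOrigin (N + 2), (#(hexSlots ω) : ℝ) / ((#(hexSharp ω) : ℝ) + 24) ≤ (hexSawCount (N + 4) : ℝ) := by
  classical
  have e1 : ∑ ω ∈ sawFin hvOrigin (N + 2), (#(hexSlots ω) : ℝ) / ((#(hexSharp ω) : ℝ) + 24) =
      ∑ p ∈ hexSlotPairs (N + 2), 1 / ((#(hexSharp p.1) : ℝ) + 24) := by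
    rw [sum_hexSlotPairs (N + 2) (fun ω => 1 / ((#(hexSharp ω) : ℝ) + 24))]
    exact sum_congr rfl fun ω _ => by rw [mul_one_div]
  have e2 : ∑ p ∈ hexSlotPairs (N + 2), 1 / ((#(hexSharp p.1) : ℝ) + 24) ≤
      ∑ p ∈ hexSlotPairs (N + 2), 1 / (#(hexSharp (hexIns p.2.1 p.2.2.1 p.2.2.2.1 p.2.2.2.2 p.1)) : ℝ) := by
    refine sum_le_sum fun p hp => ?_
    rw [hexSlotPairs, Finset.mem_sigma] at hp
    obtain ⟨hω, hs⟩ := hp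
    have hs' : (p.2.1, p.2.2.1, p.2.2.2.1, p.2.2.2.2) ∈ hexSlots p.1 := hs
    have hJ1 := one_le_card_hexSharp_hexIns hω hs'
    have hJ3 := card_hexSharp_hexIns_le hω hs'
    have hpos : (0 : ℝ) < #(hexSharp (hexIns p.2.1 p.2.2.1 p.2.2.2.1 p.2.2.2.2 p.1)) := by exact_mod_cast hJ1
    apply one_div_le_one_div_of_le hpos
    exact_mod_cast hJ3
  have e3 : ∑ p ∈ hexSlotPairs (N + 2), 1 / (#(hexSharp (hexIns p.2.1 p.2.2.1 p.2.2.2.1 p.2.2.2.2 p.1)) : ℝ) =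
      ∑ q ∈ hexSharpPairs (N + 2 + 2), 1 / (#(hexSharp q.1) : ℝ) :=
    sum_hexSlotPairs_eq_sum_hexSharpPairs (N + 2) _ (fun q => 1 / (#(hexSharp q.1) : ℝ)) fun p _ => rfl
  have e4 : ∑ q ∈ hexSharpPairs (N + 2 + 2), 1 / (#(hexSharp q.1) : ℝ) ≤ (hexSawCount (N + 4) : ℝ) := by
    rw [sum_hexSharpPairs (N + 2 + 2) (fun ω => 1 / (#(hexSharp ω) : ℝ)), show N + 4 = N + 2 + 2 by ring,
      hexSawCount_eq_card, Finset.card_eq_sum_ones, Nat.cast_sum]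
    refine sum_le_sum fun ω _ => ?_
    by_cases h : #(hexSharp ω) = 0
    · rw [h]; simp
    · rw [mul_one_div_cancel (by exact_mod_cast h)]; simp
  rw [e1]
  exact e2.trans (e3.le.trans e4)

/-- **(P2) The double transfer (Madras–Slade (7.3.7), one-step detour variant on `𝕋`)**:
`Σ_{ω ∈ S_N(𝕋)} I(ω) · max(0, I(ω) − 8) / ((J(ω)+3)(J(ω)+6)) ≤ c_{N+2}(𝕋)`, `I = #hexSlots`, `J = #hexSharp` — two detour
insertions, counted through the slot-pair/sharp-pair bijection twice, with the bookkeeping `1 ≤ J' ≤ J + 3` and `I ≤ I' + 8`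
of `SAWTriangularDetourSurgery`. [cite: MadrasSlade1993, Theorem 7.3.2 (proof), eq. (7.3.7) (p. 245)] -/
theorem hexKesten_P2 (N : ℕ) :
    ∑ ω ∈ sawFin hvOrigin N, (#(hexSlots ω) : ℝ) * max 0 ((#(hexSlots ω) : ℝ) - 324) /
        (((#(hexSharp ω) : ℝ) + 24) * ((#(hexSharp ω) : ℝ) + 48)) ≤ (hexSawCount (N + 4) : ℝ) := by
  classical
  refine le_trans ?_ (sum_card_hexSlots_div_le_hexSawCount N)
  -- level `N`: the weight `g(ω') = I'/((J'+3) J')`, so that `J' · g(ω') = I'/(J'+3)` when `J' ≥ 1`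
  set g : List HV → ℝ := fun ω' =>
    (#(hexSlots ω') : ℝ) / (((#(hexSharp ω') : ℝ) + 24) * (#(hexSharp ω') : ℝ)) with hg
  have hB : ∑ ω' ∈ sawFin hvOrigin (N + 2), (#(hexSharp ω') : ℝ) * g ω' ≤
      ∑ ω' ∈ sawFin hvOrigin (N + 2), (#(hexSlots ω') : ℝ) / ((#(hexSharp ω') : ℝ) + 24) := by
    refine sum_le_sum fun ω' _ => ?_
    by_cases h : #(hexSharp ω') = 0
    · rw [h]; simp only [Nat.cast_zero, zero_mul, zero_add]; positivity
    · have hpos : (0 : ℝ) < #(hexSharp ω') := by exact_mod_cast Nat.pos_of_ne_zero h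
      rw [hg]
      rw [show (#(hexSharp ω') : ℝ) * ((#(hexSlots ω') : ℝ) /
          (((#(hexSharp ω') : ℝ) + 24) * (#(hexSharp ω') : ℝ))) =
          (#(hexSlots ω') : ℝ) / ((#(hexSharp ω') : ℝ) + 24) by field_simp]
  refine le_trans ?_ hB
  rw [← sum_hexSharpPairs (N + 2) g]
  rw [← sum_hexSlotPairs_eq_sum_hexSharpPairs N (fun p => g (hexIns p.2.1 p.2.2.1 p.2.2.2.1 p.2.2.2.2 p.1)) (fun q => g q.1) fun p _ => rfl]
  rw [show ∑ ω ∈ sawFin hvOrigin N, (#(hexSlots ω) : ℝ) * max 0 ((#(hexSlots ω) : ℝ) - 324) /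
      (((#(hexSharp ω) : ℝ) + 24) * ((#(hexSharp ω) : ℝ) + 48)) =
      ∑ ω ∈ sawFin hvOrigin N, (#(hexSlots ω) : ℝ) * (max 0 ((#(hexSlots ω) : ℝ) - 324) /
      (((#(hexSharp ω) : ℝ) + 24) * ((#(hexSharp ω) : ℝ) + 48))) from
    sum_congr rfl fun ω _ => by rw [mul_div_assoc]]
  rw [← sum_hexSlotPairs N (fun ω => max 0 ((#(hexSlots ω) : ℝ) - 324) /
      (((#(hexSharp ω) : ℝ) + 24) * ((#(hexSharp ω) : ℝ) + 48)))]
  refine sum_le_sum fun p hp => ?_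
  rw [hexSlotPairs, Finset.mem_sigma] at hp
  obtain ⟨hω, hs⟩ := hp
  have hs' : (p.2.1, p.2.2.1, p.2.2.2.1, p.2.2.2.2) ∈ hexSlots p.1 := hs
  set ω' := hexIns p.2.1 p.2.2.1 p.2.2.2.1 p.2.2.2.2 p.1 with hω'
  have hJ1 : (1 : ℝ) ≤ #(hexSharp ω') := by exact_mod_cast one_le_card_hexSharp_hexIns hω hs'
  have hJ3 : (#(hexSharp ω') : ℝ) ≤ #(hexSharp p.1) + 24 := by
    exact_mod_cast card_hexSharp_hexIns_le hω hs'
  have hI : (#(hexSlots p.1) : ℝ) ≤ #(hexSlots ω') + 324 := by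
    exact_mod_cast card_hexSlots_le_hexIns hω hs'
  have hJ0 : (0 : ℝ) ≤ #(hexSharp p.1) := Nat.cast_nonneg _
  have hI0 : (0 : ℝ) ≤ #(hexSlots ω') := Nat.cast_nonneg _
  show max 0 ((#(hexSlots p.1) : ℝ) - 324) / (((#(hexSharp p.1) : ℝ) + 24) * ((#(hexSharp p.1) : ℝ) + 48)) ≤ g ω'
  rw [hg]; simp only
  have hden : ((#(hexSharp ω') : ℝ) + 24) * (#(hexSharp ω') : ℝ) ≤
      ((#(hexSharp p.1) : ℝ) + 24) * ((#(hexSharp p.1) : ℝ) + 48) := by nlinarith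
  have hden0 : 0 < ((#(hexSharp ω') : ℝ) + 24) * (#(hexSharp ω') : ℝ) := by positivity
  rcases le_or_gt ((#(hexSlots p.1) : ℝ) - 324) 0 with hneg | hpos
  · rw [max_eq_left hneg, zero_div]
    exact div_nonneg hI0 hden0.le
  · rw [max_eq_right hpos.le]
    calc ((#(hexSlots p.1) : ℝ) - 324) / (((#(hexSharp p.1) : ℝ) + 24) * ((#(hexSharp p.1) : ℝ) + 48))
        ≤ ((#(hexSlots p.1) : ℝ) - 324) / (((#(hexSharp ω') : ℝ) + 24) * (#(hexSharp ω') : ℝ)) :=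
          div_le_div_of_nonneg_left hpos.le hden0 hden
      _ ≤ (#(hexSlots ω') : ℝ) / (((#(hexSharp ω') : ℝ) + 24) * (#(hexSharp ω') : ℝ)) :=
          div_le_div_of_nonneg_right (by linarith) hden0.le

end DoubleTransfer

end Literature.Probability.RandomPlanarGeometry.SAW.HV
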